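import Summits.RiemannHypothesis.RiemannHypothesis.Theses.SignCone
import Summits.RiemannHypothesis.RiemannHypothesis.Theorems.SignConeOscillatory.Negative.WithoutNodeNonneg

/-!
# `OscSingleWindow` (crux stmt-RiemannHypothesis-18012) — negative lemma: node non-negativity stays load-bearing
# inside the single-window class
(route `SignCone`; refuter crux-attack record, `--supports` — it closes nothing)

The crux `Summit.RiemannHypothesis.RiemannHypothesis.Theses.SignCone.OscSingleWindow` restricts the oscillatory
sign-cone inequality `-Re F(0) ≤ Re W_ar(F)` to node-nonnegative autocorrelation sums whose far-field negativity
is confined to ONE window `T ≤ |t| ≤ T + log 2`, `T ≥ 3`. One might hope that the confinement alone (an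
"incoherent", single-octave dip) already forces the inequality. It does not:

* `oscSingleWindow_false_without_nodeNonneg` — delete the node hypothesis `∀ n ≥ 2, 0 ≤ Re F(log n)` from the
  item (everything else verbatim, INCLUDING the single-window confinement with `T ≥ 3`): FALSE. Witness: `k = 1`,
  the two-bump test `w_c = φ(· + c/2) - φ(· - c/2)` with a NARROW bump `φ = WeilContinuous.moll 7` (radius
  `ρ = 1/8`, so the dip `(c - 1/4, c + 1/4)` of `w_c ⋆ w̃_c` has width `1/2 ≤ log 2` and sits in the single window
  `T = c - 1/4 ≥ 3`), cutoff `a = c/2 + 1`, `c = 4(1 + K)` large: exactly as in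
  `SignConeOscillatory.Negative.signConeOscillatory_false_without_nodeNonneg` (whose radius-`1` witness has a dip
  of width `4 > log 2`, i.e. is NOT single-window), the polar term `-8 sinh²(c/4) φ̂(0) φ̂(1)` beats the `c`-free
  archimedean bound `weilArchIntegral_twoBump_le` and `Re G(0)(1 - log π) ≤ 0`.

Reading for provers: within the single high window the arithmetic still enters ONLY through the node signs
`Re F(log n) ≥ 0`, `e^T ≤ n ≤ 2e^T` — the "lattice" of the item's informal mechanism; window geometry, support
and positive-definiteness alone do not bound the polar term. Any proof must consume `hn` at nodes inside the
window (the witness is node-negative precisely at the integers `n ∈ (e^{c-1/4}, e^{c+1/4})`).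
-/

noncomputable section

-- `Summit.RiemannHypothesis.RiemannHypothesis.…` repeats a namespace component by design (D-0017 layout).
set_option linter.dupNamespace false

open scoped BigOperators ComplexConjugate Topology
open Complex MeasureTheory Set Filter

namespace Summit.RiemannHypothesis.RiemannHypothesis.Theorems.OscSingleWindow.Negative

open Literature.NumberTheory.LFunctions
open Literature.Analysis.SpecialFunctions
open Summit.RiemannHypothesis.RiemannHypothesis.Theorems.SignCone
open Summit.RiemannHypothesis.RiemannHypothesis.Theorems.SignConeOscillatory.Negative

/-- **Node non-negativity is load-bearing for `OscSingleWindow`.** The crux with its node hypothesis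
`∀ n ≥ 2, 0 ≤ Re F(log n)` deleted (everything else verbatim, the single-window confinement with `T ≥ 3` kept)
is false: witness `k = 1`, the two-bump test `w_c = φ(· + c/2) - φ(· - c/2)` (`φ = WeilContinuous.moll 7`,
radius `1/8`) at cutoff `a = c/2 + 1` with `c = 4(1 + K)`, `K = max 0 (D/(2π P))`, `P = 8 φ̂(0) φ̂(1) > 0`, `D` the
`c`-free bound of `weilArchIntegral_twoBump_le`; its far-field negativity lies in `(c - 1/4, c + 1/4)`, one window
with `T = c - 1/4 ≥ 3`. [folklore] -/
theorem oscSingleWindow_false_without_nodeNonneg :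
    ¬ (∀ a : ℝ, 0 < a → ∀ (k : ℕ) (g : Fin k → ℝ → ℂ), (∀ i, (ContDiff ℝ ((⊤ : ℕ∞) : WithTop ℕ∞) (g i) ∧ HasCompactSupport (g i)) ∧ tsupport (g i) ⊆ Set.Icc (-a) a) → let F : ℝ → ℂ := fun t => ∑ i, MeasureTheory.convolution (g i) (fun u => (starRingEnd ℂ) ((g i) (-u))) (ContinuousLinearMap.mul ℂ ℂ) MeasureTheory.MeasureSpace.volume t; (∃ T : ℝ, 3 ≤ T ∧ ∀ t : ℝ, Real.log 2 ≤ |t| → (F t).re < 0 → T ≤ |t| ∧ |t| ≤ T + Real.log 2) → (∃ t : ℝ, Real.log 2 ≤ |t| ∧ (F t).re < 0) → let M : ℂ → ℂ := fun s => ∫ u : ℝ, F u * Complex.exp ((s - 1 / 2) * u); -(F 0).re ≤ (M 0 + M 1 + ((1 / (2 * Real.pi) : ℂ) * (∫ t : ℝ, M (1 / 2 + t * Complex.I) * ((Complex.digamma (1 / 4 + t / 2 * Complex.I)).re : ℂ)) - F 0 * (Real.log Real.pi : ℂ))).re) := by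
  intro h
  -- the `c`-free constants
  set I0 : ℝ := ∫ t : ℝ, (WeilContinuous.bump 7).normed volume t * Real.exp (-(t / 2)) with hI0
  set I1 : ℝ := ∫ t : ℝ, (WeilContinuous.bump 7).normed volume t * Real.exp (t / 2) with hI1
  have hI0pos : 0 < I0 := by
    have := integral_bump_normed_mul_exp_pos 7 (-(1 / 2))
    rw [hI0]; convert this using 3; ring_nf
  have hI1pos : 0 < I1 := by
    have := integral_bump_normed_mul_exp_pos 7 (1 / 2)
    rw [hI1]; convert this using 3; ring_nf
  set P : ℝ := 8 * I0 * I1 with hP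
  have hPpos : 0 < P := by positivity
  set D : ℝ := 4 * (∫ t : ℝ, ‖weilMellin (WeilContinuous.moll 7) (1 / 2 + t * I)‖ ^ 2 *
      (reDigammaQuarter t - reDigammaQuarter 0)) +
    4 * |reDigammaQuarter 0| * ∫ t : ℝ, ‖weilMellin (WeilContinuous.moll 7) (1 / 2 + t * I)‖ ^ 2 with hD
  set K : ℝ := max 0 (D / (2 * Real.pi * P)) with hK
  have hK0 : 0 ≤ K := le_max_left _ _
  have hKD : D / (2 * Real.pi) ≤ P * K := by
    have h1 : D / (2 * Real.pi * P) ≤ K := le_max_right _ _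
    have h2 : P * (D / (2 * Real.pi * P)) = D / (2 * Real.pi) := by
      field_simp
    calc D / (2 * Real.pi) = P * (D / (2 * Real.pi * P)) := h2.symm
      _ ≤ P * K := mul_le_mul_of_nonneg_left h1 hPpos.le
  set c : ℝ := 4 * (1 + K) with hc
  have hc4 : 4 ≤ c := by rw [hc]; linarith
  have hsinh : 1 + K ≤ Real.sinh (c / 4) := by
    rw [show c / 4 = 1 + K by rw [hc]; ring]
    exact Real.self_le_sinh_iff.2 (by linarith)
  have hkey_ineq : D / (2 * Real.pi) < P * Real.sinh (c / 4) ^ 2 := by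
    have h1 : (1 + K) ^ 2 ≤ Real.sinh (c / 4) ^ 2 := pow_le_pow_left₀ (by linarith) hsinh 2
    have h2 : K < (1 + K) ^ 2 := by nlinarith
    nlinarith
  -- the witness (narrow bumps: radius `1/8`, dip width `1/2 ≤ log 2`)
  have hρ : (WeilContinuous.bump 7).rOut = 1 / 8 := by rw [WeilContinuous.bump_rOut]; norm_num
  have hlog2 := Real.log_two_gt_d9
  have hlog2' := Real.log_two_lt_d9
  set w : ℝ → ℂ := fun u => WeilContinuous.moll 7 (u + c / 2) - WeilContinuous.moll 7 (u - c / 2) with hw_def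
  have hw : IsWeilTest w := isWeilTest_twoBump 7 c
  set G : ℝ → ℂ := weilConv w (weilReflect w) with hG_def
  set g : Fin 1 → ℝ → ℂ := fun _ => w with hg_def
  set F : ℝ → ℂ := fun t => ∑ i, weilConv (g i) (weilReflect (g i)) t with hF_def
  have hFG : F = G := by
    funext t
    simp [hF_def, hg_def, hG_def]
  have ha : 0 < c / 2 + 1 := by linarith
  have hc0 : 0 ≤ c := by linarith
  have hg : ∀ i, (ContDiff ℝ ((⊤ : ℕ∞) : WithTop ℕ∞) (g i) ∧ HasCompactSupport (g i)) ∧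
      tsupport (g i) ⊆ Set.Icc (-(c / 2 + 1)) (c / 2 + 1) := by
    intro i
    refine ⟨hw, ?_⟩
    have := tsupport_twoBump_subset 7 (c := c) hc0
    rw [hρ] at this
    exact this.trans (Icc_subset_Icc (by linarith) (by linarith))
  have hosc : ∃ t : ℝ, Real.log 2 ≤ |t| ∧ (F t).re < 0 := by
    refine ⟨c, ?_, ?_⟩
    · rw [abs_of_pos (by linarith)]
      linarith
    · rw [hFG]
      exact re_weilConv_twoBump_neg 7 (by rw [hρ]; linarith)
  -- the single window `T = c - 1/4`
  have hzero : ∀ s : ℝ, 2 * (WeilContinuous.bump 7).rOut ≤ s → 2 * (WeilContinuous.bump 7).rOut ≤ |s - c| →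
      G s = 0 := fun s hs hsc => weilConv_twoBump_eq_zero 7 hc0 hs hsc
  have hre : ∀ s : ℝ, (G (-s)).re = (G s).re := by
    intro s
    show (weilConv w (weilReflect w) (-s)).re = (weilConv w (weilReflect w) s).re
    rw [← conj_weilConv_weilReflect_neg w s, Complex.conj_re]
  have hwinG : ∀ s : ℝ, 0 ≤ s → Real.log 2 ≤ s → (G s).re < 0 → c - 1 / 4 < s ∧ s < c + 1 / 4 := by
    intro s _ hs2 hsneg
    have hs8 : 2 * (WeilContinuous.bump 7).rOut ≤ s := by rw [hρ]; linarith
    by_contra hcon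
    have hfar : 2 * (WeilContinuous.bump 7).rOut ≤ |s - c| := by
      rw [hρ]
      rcases not_and_or.1 hcon with h1 | h1
      · have h1' := not_lt.1 h1
        rw [abs_of_nonpos (by linarith)]
        linarith
      · have h1' := not_lt.1 h1
        rw [abs_of_nonneg (by linarith)]
        linarith
    have h0 := hzero s hs8 hfar
    rw [h0, Complex.zero_re] at hsneg
    exact lt_irrefl _ hsneg
  have hwin : ∃ T : ℝ, 3 ≤ T ∧ ∀ t : ℝ, Real.log 2 ≤ |t| → (F t).re < 0 → T ≤ |t| ∧ |t| ≤ T + Real.log 2 := by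
    refine ⟨c - 1 / 4, by linarith, fun t ht hneg => ?_⟩
    rw [hFG] at hneg
    rcases le_or_gt 0 t with ht0 | ht0
    · rw [abs_of_nonneg ht0] at ht ⊢
      have hk := hwinG t ht0 ht hneg
      constructor <;> linarith
    · rw [abs_of_neg ht0] at ht ⊢
      have hneg' : (G (-t)).re < 0 := by rw [hre]; exact hneg
      have hk := hwinG (-t) (by linarith) ht hneg'
      constructor <;> linarith
  -- the mutated statement at the witness, in the Literature vocabulary (definitional unfolding)
  have key : -(F 0).re ≤ (weilPolarTerm F + weilArchTerm F).re := h (c / 2 + 1) ha 1 g hg hwin hosc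
  rw [hFG] at key
  -- the three terms
  have hG0 : G 0 = ((∫ t : ℝ, ‖w t‖ ^ 2 : ℝ) : ℂ) := weilConv_weilReflect_apply_zero w
  have hG0nn : 0 ≤ (G 0).re := by
    rw [hG0, Complex.ofReal_re]
    exact integral_nonneg fun t => sq_nonneg _
  have hpol : (weilPolarTerm G).re = -8 * Real.sinh (c / 4) ^ 2 * I0 * I1 := re_weilPolarTerm_twoBump 7 c
  have hAI : weilArchIntegral G = ((∫ t : ℝ, ‖weilMellin w (1 / 2 + t * I)‖ ^ 2 * reDigammaQuarter t : ℝ) : ℂ) :=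
    weilArchIntegral_weilConv_weilReflect hw
  have hAIle : (∫ t : ℝ, ‖weilMellin w (1 / 2 + t * I)‖ ^ 2 * reDigammaQuarter t) ≤ D :=
    weilArchIntegral_twoBump_le 7 c
  have harch : (weilArchTerm G).re =
      1 / (2 * Real.pi) * (∫ t : ℝ, ‖weilMellin w (1 / 2 + t * I)‖ ^ 2 * reDigammaQuarter t) -
        (G 0).re * Real.log Real.pi := by
    unfold weilArchTerm
    rw [hAI, hG0]
    have e : (1 / (2 * Real.pi) : ℂ) = ((1 / (2 * Real.pi) : ℝ) : ℂ) := by push_cast; ring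
    rw [e, ← Complex.ofReal_mul, ← Complex.ofReal_mul, ← Complex.ofReal_sub, Complex.ofReal_re,
      Complex.ofReal_re]
  -- assemble
  have hlogpi := one_le_log_pi
  have hpi : 0 < 2 * Real.pi := by positivity
  rw [Complex.add_re, hpol, harch] at key
  have h3 : 1 / (2 * Real.pi) * (∫ t : ℝ, ‖weilMellin w (1 / 2 + t * I)‖ ^ 2 * reDigammaQuarter t) ≤
      D / (2 * Real.pi) := by
    rw [div_eq_mul_one_div D, mul_comm D]
    exact mul_le_mul_of_nonneg_left hAIle (by positivity)
  have h4 : (G 0).re * 1 ≤ (G 0).re * Real.log Real.pi := mul_le_mul_of_nonneg_left hlogpi hG0nn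
  nlinarith [hkey_ineq, h3, h4, hG0nn, sq_nonneg (Real.sinh (c / 4)), hI0pos, hI1pos]

end Summit.RiemannHypothesis.RiemannHypothesis.Theorems.OscSingleWindow.Negative

end
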